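import Summits.NavierStokesRegularity.NavierStokesRegularity.Theorems.CircuitPump.Negative.LoadBearing

/-!
# `CircuitPump` (stmt-NavierStokesRegularity-1834): Type I self-improves — round 1 and the fences

Negative-side a-priori lemmas for the crux `PerpetualPump.CircuitPump` (cdisprove seat, work file
`Cruxes/CircuitPump/Disproof.lean` §(e1)), part 1 of 2 (part 2: `Negative/CriticalBound.lean`, the theorem
`typeI_critical_bound`: Type I ⇒ `sup lam^{n/5}|X_{i,n}(t)| < ∞`). Here: pointwise consequences of the Type-I bound
for a solution of a viscous Tao circuit on `(-∞,0)` (`abs_le_of_typeI`, `monomial_abs_le`, `abs_rhsF_le`: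
`|F_{i,n}| ≤ lam^{4n/5}|X_{i,n}| + S_i C² lam^{1/5} lam^{-n/5}/(-t)`), two explicit ODE fences
(`fence_one`, `fence_two` = `image_norm_le_of_norm_deriv_right_le_deriv_boundary'` with hand-made barriers in
`(-x)^{1/2}`, `(-x)^{-1/4}`, `(-x)^{3/4}`), and ROUND 1 (`round_one`): on every mode,
`lam^{n/5}|X_{i,n}(t)| ≤ 3C + 4K (lam^{4n/5}(-t))^{-1/4}`. No self-similarity is used. Sorry-free.
-/

set_option linter.dupNamespace false

noncomputable section

open scoped BigOperators
open Real Set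

namespace Summit.NavierStokesRegularity.NavierStokesRegularity.Theorems.CircuitPumpNegative

variable {m : ℕ}

/-! ## Pointwise consequences of the Type-I bound -/

/-- Unpacking Type I: `|X_{i,n}(t)| ≤ C·lam^{-3n/5}/√(-t)`. -/
theorem abs_le_of_typeI {lam : ℝ} (hlam : 1 < lam) {X : Fin m → ℤ → ℝ → ℝ} {C : ℝ}
    (hTI : ∀ (i : Fin m) (n : ℤ) (t : ℝ), t < 0 → lam ^ ((3 / 5 : ℝ) * n) * |X i n t| ≤ C / Real.sqrt (-t))
    (i : Fin m) (n : ℤ) (t : ℝ) (ht : t < 0) :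
    |X i n t| ≤ C * lam ^ (-((3 / 5 : ℝ) * n)) / Real.sqrt (-t) := by
  have hpos : 0 < lam := by linarith
  have hw : 0 < lam ^ ((3 / 5 : ℝ) * n) := Real.rpow_pos_of_pos hpos _
  have h := hTI i n t ht
  have hinv : lam ^ (-((3 / 5 : ℝ) * n)) = (lam ^ ((3 / 5 : ℝ) * n))⁻¹ := Real.rpow_neg hpos.le _
  rw [hinv]
  rw [mul_comm] at h
  have := (le_div_iff₀ hw).2 h
  calc |X i n t| ≤ C / Real.sqrt (-t) / lam ^ ((3 / 5 : ℝ) * n) := this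
    _ = C * (lam ^ ((3 / 5 : ℝ) * n))⁻¹ / Real.sqrt (-t) := by ring

/-- The Type-I constant is nonnegative as soon as there is one mode (take any `t < 0`). -/
theorem typeI_const_nonneg {lam : ℝ} (hlam : 1 < lam) {X : Fin m → ℤ → ℝ → ℝ} {C : ℝ}
    (hTI : ∀ (i : Fin m) (n : ℤ) (t : ℝ), t < 0 → lam ^ ((3 / 5 : ℝ) * n) * |X i n t| ≤ C / Real.sqrt (-t))
    (i : Fin m) : 0 ≤ C := by
  have hpos : 0 < lam := by linarith
  have h := hTI i 0 (-1) (by norm_num)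
  have h1 : 0 ≤ lam ^ ((3 / 5 : ℝ) * ((0 : ℤ) : ℝ)) * |X i 0 (-1)| :=
    mul_nonneg (Real.rpow_nonneg hpos.le _) (abs_nonneg _)
  have : (0 : ℝ) ≤ C / Real.sqrt (-(-1 : ℝ)) := h1.trans h
  simpa using this

/-- One nonlinear monomial under Type I: for offsets `d, o₁, o₂` with `-d - 3(o₁+o₂)/5 ≤ 1/5` (true for all four
offset labels of Tao's shift set), `|c·lam^{n-d}·X_{i₁,n+o₁}·X_{i₂,n+o₂}| ≤ |c| C² lam^{1/5} lam^{-n/5}/(-t)`. -/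
theorem monomial_abs_le {lam : ℝ} (hlam : 1 < lam) {X : Fin m → ℤ → ℝ → ℝ} {C : ℝ}
    (hTI : ∀ (i : Fin m) (n : ℤ) (t : ℝ), t < 0 → lam ^ ((3 / 5 : ℝ) * n) * |X i n t| ≤ C / Real.sqrt (-t))
    (c d : ℝ) (o₁ o₂ : ℤ) (hd : -d - 3 * ((o₁ : ℝ) + o₂) / 5 ≤ 1 / 5)
    (i₁ i₂ : Fin m) (n : ℤ) (t : ℝ) (ht : t < 0) :
    |c * lam ^ ((n : ℝ) - d) * X i₁ (n + o₁) t * X i₂ (n + o₂) t| ≤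
      |c| * C ^ 2 * lam ^ (1 / 5 : ℝ) * lam ^ (-((1 / 5 : ℝ) * n)) / (-t) := by
  have hpos : 0 < lam := by linarith
  have hnt : 0 < -t := by linarith
  have hC : 0 ≤ C := typeI_const_nonneg hlam hTI i₁
  have hsq : 0 < Real.sqrt (-t) := Real.sqrt_pos.2 hnt
  have h1 := abs_le_of_typeI hlam hTI i₁ (n + o₁) t ht
  have h2 := abs_le_of_typeI hlam hTI i₂ (n + o₂) t ht
  have hb1 : 0 ≤ C * lam ^ (-((3 / 5 : ℝ) * ((n + o₁ : ℤ) : ℝ))) / Real.sqrt (-t) := by positivity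
  -- product of the two bounds
  have hprod : |X i₁ (n + o₁) t| * |X i₂ (n + o₂) t| ≤
      (C * lam ^ (-((3 / 5 : ℝ) * ((n + o₁ : ℤ) : ℝ))) / Real.sqrt (-t)) *
        (C * lam ^ (-((3 / 5 : ℝ) * ((n + o₂ : ℤ) : ℝ))) / Real.sqrt (-t)) :=
    mul_le_mul h1 h2 (abs_nonneg _) hb1
  -- exponent bookkeeping
  have hexp : lam ^ ((n : ℝ) - d) * (lam ^ (-((3 / 5 : ℝ) * ((n + o₁ : ℤ) : ℝ))) *
      lam ^ (-((3 / 5 : ℝ) * ((n + o₂ : ℤ) : ℝ)))) ≤ lam ^ (1 / 5 : ℝ) * lam ^ (-((1 / 5 : ℝ) * n)) := by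
    rw [← Real.rpow_add hpos, ← Real.rpow_add hpos, ← Real.rpow_add hpos]
    apply Real.rpow_le_rpow_of_exponent_le hlam.le
    push_cast
    linarith
  have hsqsq : Real.sqrt (-t) * Real.sqrt (-t) = -t := Real.mul_self_sqrt hnt.le
  rw [abs_mul, abs_mul, abs_mul, abs_of_pos (Real.rpow_pos_of_pos hpos _)]
  calc |c| * lam ^ ((n : ℝ) - d) * |X i₁ (n + o₁) t| * |X i₂ (n + o₂) t|
      = |c| * lam ^ ((n : ℝ) - d) * (|X i₁ (n + o₁) t| * |X i₂ (n + o₂) t|) := by ring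
    _ ≤ |c| * lam ^ ((n : ℝ) - d) * ((C * lam ^ (-((3 / 5 : ℝ) * ((n + o₁ : ℤ) : ℝ))) / Real.sqrt (-t)) *
        (C * lam ^ (-((3 / 5 : ℝ) * ((n + o₂ : ℤ) : ℝ))) / Real.sqrt (-t))) :=
        mul_le_mul_of_nonneg_left hprod (by positivity)
    _ = |c| * C ^ 2 * (lam ^ ((n : ℝ) - d) * (lam ^ (-((3 / 5 : ℝ) * ((n + o₁ : ℤ) : ℝ))) *
        lam ^ (-((3 / 5 : ℝ) * ((n + o₂ : ℤ) : ℝ))))) / (Real.sqrt (-t) * Real.sqrt (-t)) := by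
        field_simp
    _ ≤ |c| * C ^ 2 * (lam ^ (1 / 5 : ℝ) * lam ^ (-((1 / 5 : ℝ) * n))) / (Real.sqrt (-t) * Real.sqrt (-t)) := by
        apply div_le_div_of_nonneg_right _ (by positivity)
        exact mul_le_mul_of_nonneg_left hexp (by positivity)
    _ = |c| * C ^ 2 * lam ^ (1 / 5 : ℝ) * lam ^ (-((1 / 5 : ℝ) * n)) / (-t) := by rw [hsqsq]; ring

/-- The offset labels of the crux all satisfy the exponent condition of `monomial_abs_le`. -/
theorem offset_exponent_le (μ : Option (Fin 3)) :
    -((if μ = some 2 then 1 else 0 : ℝ)) -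
        3 * (((((if μ = some 0 then 1 else 0) - (if μ = some 2 then 1 else 0) : ℤ)) : ℝ) +
          ((((if μ = some 1 then 1 else 0) - (if μ = some 2 then 1 else 0) : ℤ)) : ℝ)) / 5 ≤ 1 / 5 := by
  rcases μ with _ | j
  · simp
  · fin_cases j <;> simp <;> norm_num

/-- The sum of the absolute structure constants feeding mode `i`. -/
def coeffSum (coeff : Fin m → Fin m → Fin m → Option (Fin 3) → ℝ) (i : Fin m) : ℝ :=
  ∑ i₁ : Fin m, ∑ i₂ : Fin m, ∑ μ : Option (Fin 3), |coeff i₁ i₂ i μ|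

/-- `coeffSum` is nonnegative. -/
theorem coeffSum_nonneg (coeff : Fin m → Fin m → Fin m → Option (Fin 3) → ℝ) (i : Fin m) :
    0 ≤ coeffSum coeff i := by
  unfold coeffSum; positivity

/-- ROUND-1 BOUND ON THE RIGHT-HAND SIDE under Type I:
`|F_{i,n}(t)| ≤ lam^{4n/5}|X_{i,n}(t)| + S_i C² lam^{1/5} lam^{-n/5}/(-t)`. -/
theorem abs_rhsF_le {lam : ℝ} (hlam : 1 < lam) (coeff : Fin m → Fin m → Fin m → Option (Fin 3) → ℝ)
    {X : Fin m → ℤ → ℝ → ℝ} {C : ℝ}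
    (hTI : ∀ (i : Fin m) (n : ℤ) (t : ℝ), t < 0 → lam ^ ((3 / 5 : ℝ) * n) * |X i n t| ≤ C / Real.sqrt (-t))
    (i : Fin m) (n : ℤ) (t : ℝ) (ht : t < 0) :
    |rhsF lam coeff X i n t| ≤ lam ^ ((4 / 5 : ℝ) * n) * |X i n t| +
      coeffSum coeff i * C ^ 2 * lam ^ (1 / 5 : ℝ) * lam ^ (-((1 / 5 : ℝ) * n)) / (-t) := by
  have hpos : 0 < lam := by linarith
  unfold rhsF
  refine (abs_add_le _ _).trans (add_le_add ?_ ?_)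
  · rw [abs_mul, abs_neg, abs_of_pos (Real.rpow_pos_of_pos hpos _)]
  · refine (Finset.abs_sum_le_sum_abs _ _).trans ?_
    unfold coeffSum
    rw [Finset.sum_mul, Finset.sum_mul, Finset.sum_mul, Finset.sum_div]
    refine Finset.sum_le_sum fun i₁ _ => ?_
    refine (Finset.abs_sum_le_sum_abs _ _).trans ?_
    rw [Finset.sum_mul, Finset.sum_mul, Finset.sum_mul, Finset.sum_div]
    refine Finset.sum_le_sum fun i₂ _ => ?_
    refine (Finset.abs_sum_le_sum_abs _ _).trans ?_
    rw [Finset.sum_mul, Finset.sum_mul, Finset.sum_mul, Finset.sum_div]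
    refine Finset.sum_le_sum fun μ _ => ?_
    exact monomial_abs_le hlam hTI (coeff i₁ i₂ i μ) _ _ _ (offset_exponent_le μ) i₁ i₂ n t ht


/-! ## Two explicit fences (ODE comparison with hand-made barriers) -/

/-- Derivative of `x ↦ (-x)^p` at `x < 0`. -/
theorem hasDerivAt_neg_rpow {x : ℝ} (hx : x < 0) (p : ℝ) :
    HasDerivAt (fun y : ℝ => (-y) ^ p) (-(p * (-x) ^ (p - 1))) x := by
  have hneg : HasDerivAt (fun y : ℝ => -y) (-1) x := hasDerivAt_neg x
  have hpow : HasDerivAt (fun z : ℝ => z ^ p) (p * (-x) ^ (p - 1)) (-x) :=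
    Real.hasDerivAt_rpow_const (Or.inl (by linarith))
  have h' : HasDerivAt (fun y : ℝ => (-y) ^ p) (p * (-x) ^ (p - 1) * -1) x := hpow.comp x hneg
  exact h'.congr_deriv (by ring)

/-- FENCE 1: if `|f'| ≤ P(-x)^{-1/2} + Q(-x)^{-5/4}` on `[t₀, t] ⊂ (-∞,0)` then
`|f t| ≤ |f t₀| + 2P((-t₀)^{1/2} - (-t)^{1/2}) + 4Q((-t)^{-1/4} - (-t₀)^{-1/4})`. -/
theorem fence_one {f f' : ℝ → ℝ} {t₀ t P Q : ℝ} (ht₀ : t₀ ≤ t) (ht : t < 0)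
    (hf : ∀ x ∈ Icc t₀ t, HasDerivAt f (f' x) x)
    (hb : ∀ x ∈ Ico t₀ t, |f' x| ≤ P * (-x) ^ (-(1 / 2 : ℝ)) + Q * (-x) ^ (-(5 / 4 : ℝ))) :
    |f t| ≤ |f t₀| + 2 * P * ((-t₀) ^ (1 / 2 : ℝ) - (-t) ^ (1 / 2 : ℝ)) +
      4 * Q * ((-t) ^ (-(1 / 4 : ℝ)) - (-t₀) ^ (-(1 / 4 : ℝ))) := by
  set B : ℝ → ℝ := fun x => |f t₀| + 2 * P * ((-t₀) ^ (1 / 2 : ℝ) - (-x) ^ (1 / 2 : ℝ)) +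
      4 * Q * ((-x) ^ (-(1 / 4 : ℝ)) - (-t₀) ^ (-(1 / 4 : ℝ))) with hB
  set B' : ℝ → ℝ := fun x => P * (-x) ^ (-(1 / 2 : ℝ)) + Q * (-x) ^ (-(5 / 4 : ℝ)) with hB'
  have hderiv : ∀ x : ℝ, x < 0 → HasDerivAt B (B' x) x := by
    intro x hx
    have h1 := hasDerivAt_neg_rpow hx (1 / 2 : ℝ)
    have h2 := hasDerivAt_neg_rpow hx (-(1 / 4 : ℝ))
    have h3 : HasDerivAt (fun y : ℝ => |f t₀| + 2 * P * ((-t₀) ^ (1 / 2 : ℝ) - (-y) ^ (1 / 2 : ℝ)) +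
        4 * Q * ((-y) ^ (-(1 / 4 : ℝ)) - (-t₀) ^ (-(1 / 4 : ℝ))))
        (0 + 2 * P * (0 - -((1 / 2 : ℝ) * (-x) ^ ((1 / 2 : ℝ) - 1))) +
          4 * Q * (-(-(1 / 4 : ℝ) * (-x) ^ (-(1 / 4 : ℝ) - 1)) - 0)) x :=
      ((hasDerivAt_const x _).add ((hasDerivAt_const x _).sub h1 |>.const_mul _)).add
        ((h2.sub (hasDerivAt_const x _)).const_mul _)
    refine h3.congr_deriv ?_
    simp only [hB']
    norm_num
    ring
  have hfc : ContinuousOn f (Icc t₀ t) := fun x hx => (hf x hx).continuousAt.continuousWithinAt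
  have hf' : ∀ x ∈ Ico t₀ t, HasDerivWithinAt f (f' x) (Ici x) x :=
    fun x hx => (hf x (Ico_subset_Icc_self hx)).hasDerivWithinAt
  have hBc : ContinuousOn B (Icc t₀ t) :=
    fun x hx => (hderiv x (lt_of_le_of_lt hx.2 ht)).continuousAt.continuousWithinAt
  have hB'w : ∀ x ∈ Ico t₀ t, HasDerivWithinAt B (B' x) (Ici x) x :=
    fun x hx => (hderiv x (lt_trans hx.2 ht)).hasDerivWithinAt
  have ha : ‖f t₀‖ ≤ B t₀ := by simp [hB]
  have hbound : ∀ x ∈ Ico t₀ t, ‖f' x‖ ≤ B' x := fun x hx => by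
    simpa [hB', Real.norm_eq_abs] using hb x hx
  have key := image_norm_le_of_norm_deriv_right_le_deriv_boundary' hfc hf' ha hBc hB'w hbound
    (right_mem_Icc.2 ht₀)
  simpa [hB, Real.norm_eq_abs] using key

/-- FENCE 2: if `|f'| ≤ R₀ + R₁(-x)^{-1/4} + R₂(-x)^{-1/2}` on `[t₀, t] ⊂ (-∞,0)` then
`|f t| ≤ |f t₀| + R₀(t - t₀) + (4/3)R₁((-t₀)^{3/4} - (-t)^{3/4}) + 2R₂((-t₀)^{1/2} - (-t)^{1/2})`. -/
theorem fence_two {f f' : ℝ → ℝ} {t₀ t R₀ R₁ R₂ : ℝ} (ht₀ : t₀ ≤ t) (ht : t < 0)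
    (hf : ∀ x ∈ Icc t₀ t, HasDerivAt f (f' x) x)
    (hb : ∀ x ∈ Ico t₀ t, |f' x| ≤ R₀ + R₁ * (-x) ^ (-(1 / 4 : ℝ)) + R₂ * (-x) ^ (-(1 / 2 : ℝ))) :
    |f t| ≤ |f t₀| + R₀ * (t - t₀) + 4 / 3 * R₁ * ((-t₀) ^ (3 / 4 : ℝ) - (-t) ^ (3 / 4 : ℝ)) +
      2 * R₂ * ((-t₀) ^ (1 / 2 : ℝ) - (-t) ^ (1 / 2 : ℝ)) := by
  set B : ℝ → ℝ := fun x => |f t₀| + R₀ * (x - t₀) + 4 / 3 * R₁ * ((-t₀) ^ (3 / 4 : ℝ) - (-x) ^ (3 / 4 : ℝ)) +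
      2 * R₂ * ((-t₀) ^ (1 / 2 : ℝ) - (-x) ^ (1 / 2 : ℝ)) with hB
  set B' : ℝ → ℝ := fun x => R₀ + R₁ * (-x) ^ (-(1 / 4 : ℝ)) + R₂ * (-x) ^ (-(1 / 2 : ℝ)) with hB'
  have hderiv : ∀ x : ℝ, x < 0 → HasDerivAt B (B' x) x := by
    intro x hx
    have h1 := hasDerivAt_neg_rpow hx (3 / 4 : ℝ)
    have h2 := hasDerivAt_neg_rpow hx (1 / 2 : ℝ)
    have h0 : HasDerivAt (fun y : ℝ => R₀ * (y - t₀)) (R₀ * (1 - 0)) x :=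
      ((hasDerivAt_id x).sub (hasDerivAt_const x _)).const_mul _
    have h3 : HasDerivAt (fun y : ℝ => |f t₀| + R₀ * (y - t₀) +
        4 / 3 * R₁ * ((-t₀) ^ (3 / 4 : ℝ) - (-y) ^ (3 / 4 : ℝ)) +
        2 * R₂ * ((-t₀) ^ (1 / 2 : ℝ) - (-y) ^ (1 / 2 : ℝ)))
        (0 + R₀ * (1 - 0) + 4 / 3 * R₁ * (0 - -((3 / 4 : ℝ) * (-x) ^ ((3 / 4 : ℝ) - 1))) +
          2 * R₂ * (0 - -((1 / 2 : ℝ) * (-x) ^ ((1 / 2 : ℝ) - 1)))) x :=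
      (((hasDerivAt_const x _).add h0).add (((hasDerivAt_const x _).sub h1).const_mul _)).add
        (((hasDerivAt_const x _).sub h2).const_mul _)
    refine h3.congr_deriv ?_
    simp only [hB']
    norm_num
    ring
  have hfc : ContinuousOn f (Icc t₀ t) := fun x hx => (hf x hx).continuousAt.continuousWithinAt
  have hf' : ∀ x ∈ Ico t₀ t, HasDerivWithinAt f (f' x) (Ici x) x :=
    fun x hx => (hf x (Ico_subset_Icc_self hx)).hasDerivWithinAt
  have hBc : ContinuousOn B (Icc t₀ t) :=
    fun x hx => (hderiv x (lt_of_le_of_lt hx.2 ht)).continuousAt.continuousWithinAt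
  have hB'w : ∀ x ∈ Ico t₀ t, HasDerivWithinAt B (B' x) (Ici x) x :=
    fun x hx => (hderiv x (lt_trans hx.2 ht)).hasDerivWithinAt
  have ha : ‖f t₀‖ ≤ B t₀ := by simp [hB]
  have hbound : ∀ x ∈ Ico t₀ t, ‖f' x‖ ≤ B' x := fun x hx => by
    simpa [hB', Real.norm_eq_abs] using hb x hx
  have key := image_norm_le_of_norm_deriv_right_le_deriv_boundary' hfc hf' ha hBc hB'w hbound
    (right_mem_Icc.2 ht₀)
  simpa [hB, Real.norm_eq_abs] using key


/-! ## Round 1: Type I ⇒ `lam^{n/5}|X| ≤ 3C + 4K s^{-1/4}` -/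

/-- ROUND 1 (everywhere on `(-∞,0)`): `lam^{n/5}|X_{i,n}(t)| ≤ 3C + 4K (lam^{4n/5}(-t))^{-1/4}` with
`K = S_i C² lam^{1/5}`; for `s = lam^{4n/5}(-t) ≥ 1` this is weaker than Type I, for `s ≤ 1` it is FENCE 1 run
from `t₀ = -lam^{-4n/5}`. -/
theorem round_one {lam : ℝ} (hlam : 1 < lam) (coeff : Fin m → Fin m → Fin m → Option (Fin 3) → ℝ)
    {X : Fin m → ℤ → ℝ → ℝ} (hode : SolvesODE lam coeff X) {C : ℝ}
    (hTI : ∀ (i : Fin m) (n : ℤ) (t : ℝ), t < 0 → lam ^ ((3 / 5 : ℝ) * n) * |X i n t| ≤ C / Real.sqrt (-t))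
    (i : Fin m) (n : ℤ) (t : ℝ) (ht : t < 0) :
    lam ^ ((1 / 5 : ℝ) * n) * |X i n t| ≤
      3 * C + 4 * (coeffSum coeff i * C ^ 2 * lam ^ (1 / 5 : ℝ)) *
        (lam ^ ((4 / 5 : ℝ) * n) * (-t)) ^ (-(1 / 4 : ℝ)) := by
  have hpos : 0 < lam := by linarith
  have hnt : 0 < -t := by linarith
  have hC : 0 ≤ C := typeI_const_nonneg hlam hTI i
  -- the powers of lam attached to scale n
  obtain ⟨a, ha, hapos⟩ : ∃ a : ℝ, a = lam ^ ((4 / 5 : ℝ) * n) ∧ 0 < a := ⟨_, rfl, Real.rpow_pos_of_pos hpos _⟩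
  obtain ⟨w, hw, hwpos⟩ : ∃ w : ℝ, w = lam ^ ((1 / 5 : ℝ) * n) ∧ 0 < w := ⟨_, rfl, Real.rpow_pos_of_pos hpos _⟩
  obtain ⟨wi, hwi, hwipos⟩ : ∃ wi : ℝ, wi = lam ^ (-((1 / 5 : ℝ) * n)) ∧ 0 < wi :=
    ⟨_, rfl, Real.rpow_pos_of_pos hpos _⟩
  obtain ⟨K, hK, hKnn⟩ : ∃ K : ℝ, K = coeffSum coeff i * C ^ 2 * lam ^ (1 / 5 : ℝ) ∧ 0 ≤ K :=
    ⟨_, rfl, by have := coeffSum_nonneg coeff i; positivity⟩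
  rw [← ha, ← hw, ← hK]
  -- exponent identities
  have e_w_wi : w * wi = 1 := by
    rw [hw, hwi, ← Real.rpow_add hpos]; simp
  have e_a_w3 : a * lam ^ (-((3 / 5 : ℝ) * n)) = w := by
    rw [ha, hw, ← Real.rpow_add hpos]; congr 1; ring
  have e_w_w3 : w = lam ^ (-((2 / 5 : ℝ) * n)) * lam ^ ((3 / 5 : ℝ) * n) := by
    rw [hw, ← Real.rpow_add hpos]; congr 1; ring
  have e_ainv : a⁻¹ = lam ^ (-((4 / 5 : ℝ) * n)) := by rw [ha, Real.rpow_neg hpos.le]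
  have e_sqrt_ainv : Real.sqrt a⁻¹ = lam ^ (-((2 / 5 : ℝ) * n)) := by
    rw [e_ainv, Real.sqrt_eq_rpow, ← Real.rpow_mul hpos.le]; congr 1; ring
  have e_half_ainv : a⁻¹ ^ (1 / 2 : ℝ) = lam ^ (-((2 / 5 : ℝ) * n)) := by
    rw [← Real.sqrt_eq_rpow, e_sqrt_ainv]
  have e_w_sq : w * lam ^ (-((2 / 5 : ℝ) * n)) = lam ^ (-((1 / 5 : ℝ) * n)) := by
    rw [hw, ← Real.rpow_add hpos]; congr 1; ring
  have e_w_w : w * w * lam ^ (-((2 / 5 : ℝ) * n)) = 1 := by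
    rw [mul_assoc, e_w_sq, ← hwi, e_w_wi]
  have e_w3_w : lam ^ (-((3 / 5 : ℝ) * n)) * w = lam ^ (-((2 / 5 : ℝ) * n)) := by
    rw [hw, ← Real.rpow_add hpos]; congr 1; ring
  have e_quarter : a⁻¹ ^ (1 / 4 : ℝ) * (-t) ^ (-(1 / 4 : ℝ)) = (a * (-t)) ^ (-(1 / 4 : ℝ)) := by
    rw [Real.mul_rpow hapos.le hnt.le, Real.rpow_neg hapos.le, Real.inv_rpow hapos.le]
  by_cases hs : a * (-t) ≤ 1
  · -- FENCE 1 from t₀ = -a⁻¹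
    obtain ⟨t₀, ht₀def⟩ : ∃ t₀ : ℝ, t₀ = -a⁻¹ := ⟨_, rfl⟩
    have hnt₀ : -t₀ = a⁻¹ := by rw [ht₀def, neg_neg]
    have ht₀neg : t₀ < 0 := by rw [ht₀def]; exact neg_neg_of_pos (inv_pos.2 hapos)
    have ht₀t : t₀ ≤ t := by
      rw [ht₀def, neg_le]
      calc -t = a⁻¹ * (a * -t) := by field_simp
        _ ≤ a⁻¹ * 1 := mul_le_mul_of_nonneg_left hs (inv_nonneg.2 hapos.le)
        _ = a⁻¹ := mul_one _
    have hf : ∀ x ∈ Icc t₀ t, HasDerivAt (X i n) (rhsF lam coeff X i n x) x :=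
      fun x hx => hode i n x (lt_of_le_of_lt hx.2 ht)
    have hb : ∀ x ∈ Ico t₀ t, |rhsF lam coeff X i n x| ≤
        C * w * (-x) ^ (-(1 / 2 : ℝ)) + K * wi * (-t₀) ^ (1 / 4 : ℝ) * (-x) ^ (-(5 / 4 : ℝ)) := by
      intro x hx
      have hxneg : x < 0 := lt_trans hx.2 ht
      have hnx : 0 < -x := by linarith
      have h0 := abs_rhsF_le hlam coeff hTI i n x hxneg
      rw [← ha, ← hK, ← hwi] at h0
      refine h0.trans (add_le_add ?_ ?_)
      · -- linear term
        have h1 := abs_le_of_typeI hlam hTI i n x hxneg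
        have hsx : (Real.sqrt (-x))⁻¹ = (-x) ^ (-(1 / 2 : ℝ)) := by
          rw [Real.sqrt_eq_rpow, ← Real.rpow_neg hnx.le]
        calc a * |X i n x| ≤ a * (C * lam ^ (-((3 / 5 : ℝ) * n)) / Real.sqrt (-x)) :=
              mul_le_mul_of_nonneg_left h1 hapos.le
          _ = C * (a * lam ^ (-((3 / 5 : ℝ) * n))) * (Real.sqrt (-x))⁻¹ := by ring
          _ = C * w * (-x) ^ (-(1 / 2 : ℝ)) := by rw [e_a_w3, hsx]
      · -- nonlinear term
        have hxt₀ : -x ≤ -t₀ := by linarith [hx.1]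
        have hq : (-x) ^ (1 / 4 : ℝ) ≤ (-t₀) ^ (1 / 4 : ℝ) :=
          Real.rpow_le_rpow hnx.le hxt₀ (by norm_num)
        have hsplit : (-x)⁻¹ = (-x) ^ (-(5 / 4 : ℝ)) * (-x) ^ (1 / 4 : ℝ) := by
          rw [← Real.rpow_add hnx, ← Real.rpow_neg_one]; congr 1; norm_num
        calc K * wi / (-x) = K * wi * ((-x) ^ (-(5 / 4 : ℝ)) * (-x) ^ (1 / 4 : ℝ)) := by
              rw [div_eq_mul_inv, hsplit]
          _ ≤ K * wi * ((-x) ^ (-(5 / 4 : ℝ)) * (-t₀) ^ (1 / 4 : ℝ)) := by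
              apply mul_le_mul_of_nonneg_left _ (by positivity)
              exact mul_le_mul_of_nonneg_left hq (Real.rpow_nonneg hnx.le _)
          _ = K * wi * (-t₀) ^ (1 / 4 : ℝ) * (-x) ^ (-(5 / 4 : ℝ)) := by ring
    have key := fence_one ht₀t ht hf hb
    -- drop the favourable terms of the barrier
    have hP : 0 ≤ C * w := by positivity
    have hQ : 0 ≤ K * wi * (-t₀) ^ (1 / 4 : ℝ) := by
      have : 0 ≤ (-t₀) ^ (1 / 4 : ℝ) := Real.rpow_nonneg (by rw [hnt₀]; positivity) _
      positivity
    have hdrop : |X i n t| ≤ |X i n t₀| + 2 * (C * w) * (-t₀) ^ (1 / 2 : ℝ) +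
        4 * (K * wi * (-t₀) ^ (1 / 4 : ℝ)) * (-t) ^ (-(1 / 4 : ℝ)) := by
      have h1 : 0 ≤ (-t) ^ (1 / 2 : ℝ) := Real.rpow_nonneg hnt.le _
      have h2 : 0 ≤ (-t₀) ^ (-(1 / 4 : ℝ)) := Real.rpow_nonneg (by rw [hnt₀]; positivity) _
      nlinarith [key, mul_nonneg hP h1, mul_nonneg hQ h2]
    -- the initial value
    have hinit : |X i n t₀| ≤ C * lam ^ (-((3 / 5 : ℝ) * n)) / Real.sqrt (-t₀) :=
      abs_le_of_typeI hlam hTI i n t₀ ht₀neg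
    rw [hnt₀] at hdrop hinit
    rw [e_sqrt_ainv] at hinit
    rw [e_half_ainv] at hdrop
    -- multiply by w and simplify
    have hw2pos : 0 < lam ^ (-((2 / 5 : ℝ) * n)) := Real.rpow_pos_of_pos hpos _
    have step1 : w * |X i n t₀| ≤ C := by
      calc w * |X i n t₀| ≤ w * (C * lam ^ (-((3 / 5 : ℝ) * n)) / lam ^ (-((2 / 5 : ℝ) * n))) :=
            mul_le_mul_of_nonneg_left hinit hwpos.le
        _ = C * (lam ^ (-((3 / 5 : ℝ) * n)) * w) / lam ^ (-((2 / 5 : ℝ) * n)) := by ring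
        _ = C := by rw [e_w3_w]; field_simp
    have step2 : w * (2 * (C * w) * lam ^ (-((2 / 5 : ℝ) * n))) = 2 * C := by
      calc w * (2 * (C * w) * lam ^ (-((2 / 5 : ℝ) * n))) = 2 * C * (w * w * lam ^ (-((2 / 5 : ℝ) * n))) := by
            ring
        _ = 2 * C := by rw [e_w_w, mul_one]
    have step3 : w * (4 * (K * wi * a⁻¹ ^ (1 / 4 : ℝ)) * (-t) ^ (-(1 / 4 : ℝ))) =
        4 * K * (a * -t) ^ (-(1 / 4 : ℝ)) := by
      calc w * (4 * (K * wi * a⁻¹ ^ (1 / 4 : ℝ)) * (-t) ^ (-(1 / 4 : ℝ)))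
          = 4 * K * (w * wi) * (a⁻¹ ^ (1 / 4 : ℝ) * (-t) ^ (-(1 / 4 : ℝ))) := by ring
        _ = 4 * K * (a * -t) ^ (-(1 / 4 : ℝ)) := by rw [e_w_wi, e_quarter, mul_one]
    calc w * |X i n t| ≤ w * (|X i n t₀| + 2 * (C * w) * lam ^ (-((2 / 5 : ℝ) * n)) +
          4 * (K * wi * a⁻¹ ^ (1 / 4 : ℝ)) * (-t) ^ (-(1 / 4 : ℝ))) :=
          mul_le_mul_of_nonneg_left hdrop hwpos.le
      _ = w * |X i n t₀| + w * (2 * (C * w) * lam ^ (-((2 / 5 : ℝ) * n))) +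
          w * (4 * (K * wi * a⁻¹ ^ (1 / 4 : ℝ)) * (-t) ^ (-(1 / 4 : ℝ))) := by ring
      _ ≤ C + 2 * C + 4 * K * (a * -t) ^ (-(1 / 4 : ℝ)) := by rw [step2, step3]; linarith [step1]
      _ = 3 * C + 4 * K * (a * -t) ^ (-(1 / 4 : ℝ)) := by ring
  · -- s ≥ 1: Type I alone
    have hs : 1 < a * -t := not_le.1 hs
    have h1 := hTI i n t ht
    have hs4 : 0 ≤ (a * -t) ^ (-(1 / 4 : ℝ)) := Real.rpow_nonneg (by positivity) _
    have hle : lam ^ (-((2 / 5 : ℝ) * n)) / Real.sqrt (-t) ≤ 1 := by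
      rw [div_le_one (Real.sqrt_pos.2 hnt)]
      apply Real.le_sqrt_of_sq_le
      have : (lam ^ (-((2 / 5 : ℝ) * n))) ^ 2 = a⁻¹ := by
        rw [e_ainv, sq, ← Real.rpow_add hpos]; congr 1; ring
      rw [this]
      calc a⁻¹ = a⁻¹ * 1 := (mul_one _).symm
        _ ≤ a⁻¹ * (a * -t) := mul_le_mul_of_nonneg_left hs.le (inv_nonneg.2 hapos.le)
        _ = -t := by field_simp
    calc w * |X i n t| = lam ^ (-((2 / 5 : ℝ) * n)) * (lam ^ ((3 / 5 : ℝ) * n) * |X i n t|) := by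
          rw [e_w_w3]; ring
      _ ≤ lam ^ (-((2 / 5 : ℝ) * n)) * (C / Real.sqrt (-t)) :=
          mul_le_mul_of_nonneg_left h1 (Real.rpow_nonneg hpos.le _)
      _ = C * (lam ^ (-((2 / 5 : ℝ) * n)) / Real.sqrt (-t)) := by ring
      _ ≤ C * 1 := mul_le_mul_of_nonneg_left hle hC
      _ ≤ 3 * C + 4 * K * (a * -t) ^ (-(1 / 4 : ℝ)) := by nlinarith [mul_nonneg hKnn hs4]

end Summit.NavierStokesRegularity.NavierStokesRegularity.Theorems.CircuitPumpNegative
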